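import Mathlib
import Summits.ResolutionOfSingularities.ResolutionOfSingularities.Theorems.HomologicalConductorPersistenceCyclicQuotientAllCharFree
import Summits.ResolutionOfSingularities.ResolutionOfSingularities.Theorems.HomologicalConductorPersistenceCyclicQuotientCharFreeHerzog
import Summits.ResolutionOfSingularities.ResolutionOfSingularities.Theorems.HomologicalConductorPersistenceSurfaceSaturationIsolatedLocalization
import Literature.RingTheory.KrullDimension.AffineDimension
import HarnessLib

/-!
# Rung S-2 `PersistenceSurface` (stmt-ResolutionOfSingularities-19970), stub C1 (`Sat₄`) — the cyclic-quotient
# theorem AT THE LOCAL RING OF THE VERTEX: `caᵐ(U_𝔪) = ca⁴(U_𝔪) = ca(U_𝔪)` and `x/1 ∈ ca(U_𝔪) ↔ x ∈ ca(U)`,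
# modulo «`U` is regular off `𝔪`»

[OURS · cell decomp-res · rung S-2; seat leafhand-res-homologicalconduct-15 gen 0]  Nothing here is a statement of the
manuscript under review (Hironaka 2017); AI-written, weaker than expert review.  DEF-FREE.

The cell's theorem of record (`…PersistenceCyclicQuotientAllCharFree`, hand 13-g1) gives `caᵐ(U) = ca(U)` (`m ≥ 4`) for
the GRADED degree-`0` subalgebra `U = k[u,v]^{(n;1,q)}` of the `(1,q)`-grading of `k[u,v]` in `ZMod n`, `k` any field.  The
tower's stages are LOCAL rings.  With the localization transport of `…PersistenceSurfaceSaturationIsolatedLocalization`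
(this seat, p822891) this file records the LOCAL form at any maximal ideal `𝔪` of `U` off which `U` is regular (for the
cyclic quotient surface this is the vertex — the only singular point; that classical fact, «isolatedness», is CARRIED
AS A HYPOTHESIS `hreg` here and is the named remaining input):

* `isIntegral_degreeZero`, `ringKrullDim_degreeZero` — `k[u,v]` is integral over `U` (`uⁿ, vⁿ ∈ U`), so `dim U = 2`;
* `saturation_cyclicQuotient_atVertex_charFree` — for every maximal `𝔪 ⊆ U` with `U_𝔫` regular at every other
  maximal `𝔫`: `caᵐ(U_𝔪) = ca⁴(U_𝔪)` for all `m ≥ 4`, `ca(U_𝔪) = ca⁴(U_𝔪) = ca⁴(U)·U_𝔪`, and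
  `x/1 ∈ ca(U_𝔪) ↔ x ∈ ca(U)` (so the graded EXACT CENTRE — stable annihilation of the cospecial pieces,
  `cohomologyAnnihilator_cyclicQuotient_of_chain_charFree` — tests `ca(U_𝔪)` on numerators).

References: S. B. Iyengar, R. Takahashi, IMRN 2016, arXiv:1404.1476 [`IyengarTakahashi2014`] (vocabulary, Lemma 2.10,
Example 2.5); H. Matsumura, *Commutative Ring Theory*, Thm. 9.4 [`Matsumura1987`] (integral extensions preserve
dimension) — used only through landed tree lemmas.
-/

-- single-problem summit: the doubled namespace component `ResolutionOfSingularities` is forced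
set_option linter.dupNamespace false

noncomputable section

open MvPolynomial Literature.RingTheory.CohomologyAnnihilator
open Summit.ResolutionOfSingularities.ResolutionOfSingularities.Theorems.HomologicalConductor.PersistenceCyclicQuotientAllCharFree
open Summit.ResolutionOfSingularities.ResolutionOfSingularities.Theorems.HomologicalConductor.PersistenceCyclicQuotientCharFree
  (isNoetherianRing_degreeZero)
open Summit.ResolutionOfSingularities.ResolutionOfSingularities.Theorems.HomologicalConductor.PersistenceCyclicQuotientGradedPieces
  (whc_zero_monomial_of_dvd)
open Summit.ResolutionOfSingularities.ResolutionOfSingularities.Theorems.HomologicalConductor.PersistenceSurfaceSaturationIsolatedLocalization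

universe u

namespace Summit.ResolutionOfSingularities.ResolutionOfSingularities.Theorems.HomologicalConductor.PersistenceCyclicQuotientLocalVertex

variable {k : Type u} [Field k] {n : ℕ} [NeZero n] {q : ℕ} (U : Subalgebra k (MvPolynomial (Fin 2) k))
variable (hU : ∀ p, p ∈ U ↔ weightedHomogeneousComponent (![1, (q : ZMod n)] : Fin 2 → ZMod n) 0 p = p)

include hU in
/-- **`k[u,v]` is integral over `U = k[u,v]^{(n;1,q)}`**: constants lie in `U` and `u`, `v` are roots of `Tⁿ − uⁿ`,
`Tⁿ − vⁿ ∈ U[T]`. [folklore] -/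
theorem isIntegral_degreeZero : Algebra.IsIntegral U (MvPolynomial (Fin 2) k) := by
  have hnpos : 0 < n := Nat.pos_of_ne_zero (NeZero.ne n)
  -- a monomial all of whose exponents are multiples of `n` has weight `0`, i.e. lies in `U`
  have monomial_mem_of_dvd : ∀ (d : Fin 2 →₀ ℕ) (c : k), n ∣ d 0 → n ∣ d 1 → monomial d c ∈ U :=
    fun d c h0 h1 => (hU _).mpr (whc_zero_monomial_of_dvd q d c h0 h1)
  have hX : ∀ i : Fin 2, IsIntegral U (X i : MvPolynomial (Fin 2) k) := by
    intro i
    have hmem : (X i : MvPolynomial (Fin 2) k) ^ n ∈ U := by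
      rw [X_pow_eq_monomial]
      refine monomial_mem_of_dvd _ _ ?_ ?_ <;>
      · rw [Finsupp.single_apply]
        split_ifs <;> simp
    have hint : IsIntegral U ((X i : MvPolynomial (Fin 2) k) ^ n) := by
      have : ((X i : MvPolynomial (Fin 2) k) ^ n) = algebraMap U (MvPolynomial (Fin 2) k) ⟨_, hmem⟩ := rfl
      rw [this]
      exact isIntegral_algebraMap
    exact IsIntegral.of_pow hnpos hint
  refine ⟨fun p => ?_⟩
  induction p using MvPolynomial.induction_on with
  | C c =>
    have hmem : (C c : MvPolynomial (Fin 2) k) ∈ U := by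
      rw [C_apply]
      exact monomial_mem_of_dvd 0 c (by simp) (by simp)
    have : (C c : MvPolynomial (Fin 2) k) = algebraMap U (MvPolynomial (Fin 2) k) ⟨_, hmem⟩ := rfl
    rw [this]
    exact isIntegral_algebraMap
  | add p p' hp hp' => exact hp.add hp'
  | mul_X p i hp => exact hp.mul (hX i)

include hU in
/-- **`dim U = 2`**: `U ⊆ k[u,v]` is an integral extension (`isIntegral_degreeZero`), so the dimensions agree
(Matsumura Thm. 9.4, tree `Literature.RingTheory.KrullDimension.ringKrullDim_eq_of_isIntegral`), and `dim k[u,v] = 2`.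
[cite: Matsumura1987, Thm. 9.4] -/
theorem ringKrullDim_degreeZero : ringKrullDim U = (2 : ℕ) := by
  haveI := isIntegral_degreeZero U hU
  rw [Literature.RingTheory.KrullDimension.ringKrullDim_eq_of_isIntegral (R := U) (S := MvPolynomial (Fin 2) k)
    Subtype.val_injective, MvPolynomial.ringKrullDim_of_isNoetherianRing, ringKrullDim_eq_zero_of_field]
  simp

include hU in
/-- **`Sat₄`, LEVELLED, WITH THE EXACT CENTRE, AT THE LOCAL RING OF THE VERTEX — modulo isolatedness.**  For
`U = k[u,v]^{(n;1,q)}` (`gcd(q,n) = 1`, `k` any field) and a maximal ideal `𝔪 ⊆ U` such that `U_𝔫` is a regular local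
ring for every OTHER maximal ideal `𝔫`: `caᵐ(U_𝔪) = ca⁴(U_𝔪)` for all `m ≥ 4`, `ca(U_𝔪) = ca⁴(U_𝔪)`,
`ca⁴(U_𝔪) = ca⁴(U)·U_𝔪`, and `x/1 ∈ ca(U_𝔪) ↔ x ∈ ca(U)` for every `x ∈ U`.  (Graded theorem
`cohomologyAnnihilatorOfDegree_eq_cyclicQuotient_charFree` + `saturation_atPrime_of_isRegularLocalRing_off` with `d = 2`,
`a = 4`.) [OURS · cell decomp-res] -/
theorem saturation_cyclicQuotient_atVertex_charFree (hq : q.Coprime n) (𝔪 : Ideal U) [𝔪.IsMaximal]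
    (hreg : ∀ (𝔫 : Ideal U) [𝔫.IsMaximal], 𝔫 ≠ 𝔪 → IsRegularLocalRing (Localization.AtPrime 𝔫)) :
    (∀ m : ℕ, 4 ≤ m → cohomologyAnnihilatorOfDegree (Localization.AtPrime 𝔪) m =
        cohomologyAnnihilatorOfDegree (Localization.AtPrime 𝔪) 4) ∧
      cohomologyAnnihilator (Localization.AtPrime 𝔪) = cohomologyAnnihilatorOfDegree (Localization.AtPrime 𝔪) 4 ∧
      cohomologyAnnihilatorOfDegree (Localization.AtPrime 𝔪) 4 =
        (cohomologyAnnihilatorOfDegree U 4).map (algebraMap U (Localization.AtPrime 𝔪)) ∧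
      ∀ x : U, algebraMap U (Localization.AtPrime 𝔪) x ∈ cohomologyAnnihilator (Localization.AtPrime 𝔪) ↔
        x ∈ cohomologyAnnihilator U := by
  haveI : IsNoetherianRing U := isNoetherianRing_degreeZero (k := k) (n := n) q U hU
  have hsat : ∀ m : ℕ, 4 ≤ m → cohomologyAnnihilatorOfDegree (U : Type u) m = cohomologyAnnihilatorOfDegree U 4 := by
    intro m hm
    rw [cohomologyAnnihilatorOfDegree_eq_cyclicQuotient_charFree U hU hq hm,
      cohomologyAnnihilatorOfDegree_eq_cyclicQuotient_charFree U hU hq le_rfl]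
  exact saturation_atPrime_of_isRegularLocalRing_off 𝔪 (d := 2) (ringKrullDim_degreeZero U hU).le hreg
    (by norm_num) hsat

/-- **Levelled saturation is invariant under ring isomorphisms**: for `e : T ≃+* L`, `caᵐ(L) = ca⁴(L)` (`m ≥ 4`) and
`ca(L) = ca⁴(L)` give the same for `T` (`ca` and every `caⁿ` are transported by `e`, tree
`map_ringEquiv_cohomologyAnnihilatorOfDegree`). [folklore] -/
theorem levelledSaturation_of_ringEquiv {L T : Type u} [CommRing L] [CommRing T] (e : T ≃+* L) {a : ℕ}
    (hlev : ∀ m : ℕ, a ≤ m → cohomologyAnnihilatorOfDegree L m = cohomologyAnnihilatorOfDegree L a)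
    (hca : cohomologyAnnihilator L = cohomologyAnnihilatorOfDegree L a) :
    (∀ m : ℕ, a ≤ m → cohomologyAnnihilatorOfDegree T m = cohomologyAnnihilatorOfDegree T a) ∧
      cohomologyAnnihilator T = cohomologyAnnihilatorOfDegree T a := by
  have key : ∀ m : ℕ, cohomologyAnnihilatorOfDegree T m =
      (cohomologyAnnihilatorOfDegree L m).map (e.symm : L →+* T) := fun m =>
    (map_ringEquiv_cohomologyAnnihilatorOfDegree e.symm m).symm
  refine ⟨fun m hm => ?_, ?_⟩
  · rw [key m, key a, hlev m hm]
  · rw [← map_ringEquiv_cohomologyAnnihilator e.symm, hca, key a]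

include hU in
/-- **At every ring RING-ISOMORPHIC to the local ring of the vertex** (the form a stage `T_m ⊆ K` of the tower meets
when it IS toric, not merely analytically so): for `e : T ≃+* U_𝔪` with `𝔪`, `hreg` as above, `caᵐ(T) = ca⁴(T)` for all
`m ≥ 4` and `ca(T) = ca⁴(T)`.  No completion is involved. [OURS · cell decomp-res] -/
theorem saturation_of_ringEquiv_cyclicQuotient_atVertex_charFree (hq : q.Coprime n) (𝔪 : Ideal U) [𝔪.IsMaximal]
    (hreg : ∀ (𝔫 : Ideal U) [𝔫.IsMaximal], 𝔫 ≠ 𝔪 → IsRegularLocalRing (Localization.AtPrime 𝔫))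
    {T : Type u} [CommRing T] (e : T ≃+* Localization.AtPrime 𝔪) :
    (∀ m : ℕ, 4 ≤ m → cohomologyAnnihilatorOfDegree T m = cohomologyAnnihilatorOfDegree T 4) ∧
      cohomologyAnnihilator T = cohomologyAnnihilatorOfDegree T 4 :=
  have h := saturation_cyclicQuotient_atVertex_charFree U hU hq 𝔪 hreg
  levelledSaturation_of_ringEquiv e h.1 h.2.1

end Summit.ResolutionOfSingularities.ResolutionOfSingularities.Theorems.HomologicalConductor.PersistenceCyclicQuotientLocalVertex

end
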